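import Mathlib
import HarnessLib
import Summits.Ventures.LatticeQCDFlow.Scaling.ChiSqContraction
import Summits.Ventures.LatticeQCDFlow.Exactness.LazyLayers

/-!
# ProtocolTwoTime — two-time marginalisation of a finite non-equilibrium chain (the Markov
# property in the tree's path-space vocabulary) and the variance bookkeeping that transfers second
# moments from a marginal to its equilibrium law at `√χ²` cost

HONEST FRAMING: exact (Metropolis-corrected) sampling algorithms for lattice gauge theory;
figures of merit are autocorrelation/cost numbers at stated couplings and volumes; no
continuum-physics claim.

Venture `LatticeQCDFlow` (cell pub-lqcd), topic `Scaling`; FANOUT row 19 (`su2-snf`, GEN-5).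
OUR WORK (elementary finite sums), nothing cited as a fact.  Tools for the general-layer
WORK-VARIANCE law (`Scaling/GeneralLayerWorkVariance.lean`): row 8's `Exactness/LazyLayers`
typed the ONE-time marginalisation `E_path[g(ω_j)] = E_{μ_j}[g]` (`sum_pathLaw_mul_apply`) behind
the mean-work identity; the variance of the work needs TWO times.

* `propagate Q m g = Q_0 Q_1 ⋯ Q_{m−1} g` — conditional-mean propagation of an observable along a
  family of layers (`(propagate Q m g)(x) = E[g(x_m) | x_0 = x]`); `evolveLaw_succ_shift`;
  **`sum_mul_propagate`** — law/function duality `Σ_x ν(x)(Q_0⋯Q_{m−1}g)(x) = Σ_y (νQ_0⋯Q_{m−1})(y) g(y)`;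
* **`sum_pathLaw_mul_mul_apply`** — THE TWO-TIME MARGINALISATION: for layers with unit row sums
  and `k = j + m`, `E_path[f(ω_j) g(ω_k)] = Σ_x μ_j(x) f(x) (P_j ⋯ P_{k−1} g)(x)`;
* variance bookkeeping under a unit-mass law: `abs_sum_mul_mul_le` (Cauchy–Schwarz under a
  non-negative law), `sum_mul_sq_sub_mean_le` (the variance is the least second moment),
  `abs_sub_mean_le` (`|f − E_π f| ≤ osc f`), and **`sum_mul_sq_le_add_sqrt_chiSqDiv`** —
  `Σ μ (φ − c)² ≤ Σ π (φ − c)² + √χ²(μ ‖ π)·B·√(Σ π (φ − c)²)` for `|φ − c| ≤ B`: second moments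
  transfer from the marginal `μ` to the equilibrium law `π` at the `√χ²` cost controlled by
  `Scaling/ChiSqContraction` / `Scaling/GeneralLayerLagLaw`.

NOT CLAIMED: anything quantitative about lattice kernels; this file is bookkeeping.
-/

namespace Summit.Ventures.LatticeQCDFlow.Scaling

open Finset
open Literature.Probability.MarkovChains (IsRowStochastic stepLaw DetailedBalance IsIrreducible
  lambdaStar lawVariance lawMean lambdaStar_nonneg absSpectralGap LevinPeres2017_eq_12_8
  stepLaw_nonneg)
open Literature.Probability.ImportanceSampling (chiSqDiv chiSqDiv_def chiSqDiv_eq_sum_sq_div)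
open Summit.Ventures.LatticeQCDFlow.Exactness
open Summit.Ventures.LatticeQCDFlow.Theory2

variable {X : Type*} [Fintype X]


/-- Conditional-mean propagation along a family of layers `Q 0, Q 1, …`:
`propagate Q m g = Q_0 Q_1 ⋯ Q_{m−1} g`, i.e. `(propagate Q m g)(x) = E[g(x_m) | x_0 = x]`. -/
def propagate : (ℕ → X → X → ℝ) → ℕ → (X → ℝ) → X → ℝ
  | _, 0, g => g
  | Q, m + 1, g => fun x => ∑ y, Q 0 x y * propagate (fun i => Q (i + 1)) m g y

/-- `propagate Q 0 g = g`. -/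
@[simp] theorem propagate_zero (Q : ℕ → X → X → ℝ) (g : X → ℝ) : propagate Q 0 g = g := rfl

/-- `propagate Q (m+1) g = Q_0 (propagate (Q ∘ succ) m g)`-type unfolding. -/
theorem propagate_succ (Q : ℕ → X → X → ℝ) (m : ℕ) (g : X → ℝ) (x : X) :
    propagate Q (m + 1) g x = ∑ y, Q 0 x y * propagate (fun i => Q (i + 1)) m g y := rfl

/-- Peeling the first layer off the marginals: `μ_{j+1}[Q] = (μ Q_0)_j [Q ∘ succ]`. -/
theorem evolveLaw_succ_shift (Q : ℕ → X → X → ℝ) (μ : X → ℝ) :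
    ∀ j, evolveLaw Q μ (j + 1) = evolveLaw (fun i => Q (i + 1)) (stepLaw (Q 0) μ) j
  | 0 => rfl
  | j + 1 => by
      rw [evolveLaw_succ, evolveLaw_succ_shift Q μ j]
      rfl

/-- **Law / function duality**: pairing a law with a propagated function = pairing the propagated
law with the function: `Σ_x ν(x) (Q_0⋯Q_{m−1} g)(x) = Σ_y (ν Q_0 ⋯ Q_{m−1})(y) g(y)`. -/
theorem sum_mul_propagate : ∀ (m : ℕ) (Q : ℕ → X → X → ℝ) (ν g : X → ℝ),
    ∑ x, ν x * propagate Q m g x = ∑ y, evolveLaw Q ν m y * g y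
  | 0, Q, ν, g => by simp
  | m + 1, Q, ν, g => by
      have ih := sum_mul_propagate m (fun i => Q (i + 1)) (stepLaw (Q 0) ν) g
      rw [evolveLaw_succ_shift Q ν m, ← ih]
      simp only [propagate_succ]
      unfold stepLaw
      simp_rw [mul_sum, sum_mul]
      rw [sum_comm]
      exact sum_congr rfl fun y _ => sum_congr rfl fun x _ => by ring

/-- **Two-time marginalisation on path space.**  For layers with unit row sums and times
`j ≤ k` (`k = j + m`), the path-space mean of `f(ω_j)·g(ω_k)` is
`Σ_x μ_j(x)·f(x)·(P_j ⋯ P_{k−1} g)(x)` — the Markov property, in the tree's finite vocabulary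
(`sum_pathLaw_mul_apply` of `Exactness/LazyLayers` is the one-time case `m = 0`, `f = 1`). -/
theorem sum_pathLaw_mul_mul_apply : ∀ (n : ℕ) (μ : X → ℝ) (P : ℕ → X → X → ℝ),
    (∀ k x, ∑ y, P k x y = 1) → ∀ (j k : Fin (n + 1)) (m : ℕ) (_hk : (k : ℕ) = j + m)
    (f g : X → ℝ),
    ∑ ω : Fin (n + 1) → X, pathLaw μ (fun k : Fin n => P k) ω * (f (ω j) * g (ω k))
      = ∑ x, evolveLaw P μ j x * (f x * propagate (fun i => P (j + i)) m g x)
  | 0, μ, P, _, j, k, m, hk, f, g => by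
      have hj : j = 0 := Fin.fin_one_eq_zero j
      have hk0 : k = 0 := Fin.fin_one_eq_zero k
      subst hj; subst hk0
      have hm0 : m = 0 := by simp at hk; omega
      subst hm0
      rw [sum_path_zero]
      refine sum_congr rfl fun x _ => ?_
      simp [pathLaw, transProb]
  | n + 1, μ, P, hP, j, k, m, hk, f, g => by
      rw [sum_path_cons]
      have hpl : ∀ (x₀ : X) (ω : Fin (n + 1) → X),
          pathLaw μ (fun k : Fin (n + 1) => P k) (Fin.cons x₀ ω : Fin (n + 2) → X)
            = μ x₀ * pathLaw (P 0 x₀) (fun k : Fin n => P (k + 1)) ω := by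
        intro x₀ ω
        simp only [pathLaw, transProb_cons, Fin.cons_zero, Fin.val_zero, Fin.val_succ]
      have hrow : ∀ x₀, ∑ ω : Fin (n + 1) → X, pathLaw (P 0 x₀) (fun k : Fin n => P (k + 1)) ω
          = 1 := fun x₀ => by
        rw [sum_pathLaw _ _ (fun k x => hP (k + 1) x), hP 0 x₀]
      revert hk
      refine Fin.cases ?_ (fun i => ?_) j <;> refine Fin.cases ?_ (fun k' => ?_) k <;> intro hk
      · -- j = 0, k = 0 : both observables at time 0
        have hm0 : m = 0 := by simp at hk; omega
        subst hm0
        simp only [Fin.cons_zero, Fin.val_zero, evolveLaw_zero, propagate_zero]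
        refine sum_congr rfl fun x₀ _ => ?_
        simp_rw [hpl]
        rw [← sum_mul, ← mul_sum, hrow x₀, mul_one]
      · -- j = 0, k = k'.succ : m = k' + 1
        obtain ⟨m', rfl⟩ : ∃ m', m = m' + 1 := ⟨m - 1, by simp [Fin.val_succ] at hk; omega⟩
        have hkm : (k' : ℕ) = m' := by simp [Fin.val_succ] at hk; omega
        simp only [Fin.cons_zero, Fin.cons_succ, Fin.val_zero, evolveLaw_zero, zero_add]
        refine sum_congr rfl fun x₀ _ => ?_
        have ih := sum_pathLaw_mul_apply n (P 0 x₀) (fun k => P (k + 1)) (fun k x => hP (k + 1) x)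
          k' g
        calc ∑ ω : Fin (n + 1) → X,
              pathLaw μ (fun k : Fin (n + 1) => P k) (Fin.cons x₀ ω : Fin (n + 2) → X)
                * (f x₀ * g (ω k'))
            = μ x₀ * f x₀ * ∑ ω : Fin (n + 1) → X,
                pathLaw (P 0 x₀) (fun k : Fin n => P (k + 1)) ω * g (ω k') := by
              rw [mul_sum]
              exact sum_congr rfl fun ω _ => by rw [hpl]; ring
          _ = μ x₀ * (f x₀ * propagate (fun i => P i) (m' + 1) g x₀) := by
              rw [ih, propagate_succ, sum_mul_propagate, hkm]
              ring
      · -- j = i.succ, k = 0 : impossible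
        exfalso
        simp [Fin.val_succ] at hk
        omega
      · -- j = i.succ, k = k'.succ
        have hk' : (k' : ℕ) = i + m := by simp [Fin.val_succ] at hk; omega
        simp only [Fin.cons_succ, Fin.val_succ]
        have ih := fun x₀ => sum_pathLaw_mul_mul_apply n (P 0 x₀) (fun k => P (k + 1))
          (fun k x => hP (k + 1) x) i k' m hk' f g
        calc ∑ x₀, ∑ ω : Fin (n + 1) → X,
              pathLaw μ (fun k : Fin (n + 1) => P k) (Fin.cons x₀ ω : Fin (n + 2) → X)
                * (f (ω i) * g (ω k'))
            = ∑ x₀, μ x₀ * ∑ x, evolveLaw (fun k => P (k + 1)) (P 0 x₀) i x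
                * (f x * propagate (fun t => P (i + t + 1)) m g x) := by
              refine sum_congr rfl fun x₀ _ => ?_
              rw [← ih x₀, mul_sum]
              exact sum_congr rfl fun ω _ => by rw [hpl]; ring
          _ = ∑ x, evolveLaw P μ (i + 1) x * (f x * propagate (fun t => P (i + 1 + t)) m g x) := by
              have eP : (fun t => P (i + t + 1)) = (fun t => P (i + 1 + t)) := by
                funext t; rw [Nat.add_right_comm]
              rw [eP]
              simp_rw [evolveLaw_succ_eq_sum P μ i, sum_mul, mul_sum, mul_assoc]
              exact sum_comm


/-! ## Variance bookkeeping under a (non-negative, unit-mass) law -/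

/-- Cauchy–Schwarz under a non-negative law: `|Σ μ f g| ≤ √(Σ μ f²)·√(Σ μ g²)`. -/
theorem abs_sum_mul_mul_le {μ : X → ℝ} (hμ : ∀ x, 0 ≤ μ x) (f g : X → ℝ) :
    |∑ x, μ x * (f x * g x)|
      ≤ Real.sqrt (∑ x, μ x * f x ^ 2) * Real.sqrt (∑ x, μ x * g x ^ 2) := by
  have hcs := Finset.sum_mul_sq_le_sq_mul_sq univ (fun x => Real.sqrt (μ x) * f x)
    (fun x => Real.sqrt (μ x) * g x)
  have hs : ∀ x, Real.sqrt (μ x) ^ 2 = μ x := fun x => Real.sq_sqrt (hμ x)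
  have e1 : ∀ x, Real.sqrt (μ x) * f x * (Real.sqrt (μ x) * g x) = μ x * (f x * g x) := by
    intro x; rw [show Real.sqrt (μ x) * f x * (Real.sqrt (μ x) * g x)
      = Real.sqrt (μ x) ^ 2 * (f x * g x) by ring, hs x]
  have e2 : ∀ (w : X → ℝ) x, (Real.sqrt (μ x) * w x) ^ 2 = μ x * w x ^ 2 := by
    intro w x; rw [mul_pow, hs x]
  simp_rw [e1, e2] at hcs
  have hA : 0 ≤ ∑ x, μ x * f x ^ 2 := sum_nonneg fun x _ => mul_nonneg (hμ x) (sq_nonneg _)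
  calc |∑ x, μ x * (f x * g x)|
      ≤ Real.sqrt ((∑ x, μ x * f x ^ 2) * ∑ x, μ x * g x ^ 2) := Real.abs_le_sqrt hcs
    _ = Real.sqrt (∑ x, μ x * f x ^ 2) * Real.sqrt (∑ x, μ x * g x ^ 2) := Real.sqrt_mul hA _

/-- The variance is the least second moment: `Σ μ (φ − E_μ φ)² ≤ Σ μ (φ − c)²` (unit mass). -/
theorem sum_mul_sq_sub_mean_le {μ : X → ℝ} (hμ1 : ∑ x, μ x = 1) (φ : X → ℝ) (c : ℝ) :
    ∑ x, μ x * (φ x - ∑ y, μ y * φ y) ^ 2 ≤ ∑ x, μ x * (φ x - c) ^ 2 := by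
  set m := ∑ y, μ y * φ y with hm
  have key : ∑ x, μ x * (φ x - c) ^ 2 = ∑ x, μ x * (φ x - m) ^ 2 + (m - c) ^ 2 := by
    have e : ∀ x, μ x * (φ x - c) ^ 2
        = μ x * (φ x - m) ^ 2 + 2 * (m - c) * (μ x * φ x - μ x * m) + μ x * (m - c) ^ 2 := by
      intro x; ring
    simp_rw [e, sum_add_distrib, ← mul_sum, sum_sub_distrib, ← sum_mul, hμ1, one_mul, ← hm]
    ring
  rw [key]
  nlinarith [sq_nonneg (m - c)]

/-- Oscillation control of the centred observable: if `|f x − f y| ≤ B` for all `x, y` and `π` is a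
probability vector, then `|f x − Σ π f| ≤ B`. -/
theorem abs_sub_mean_le {π : X → ℝ} (hπ : ∀ x, 0 ≤ π x) (hπ1 : ∑ x, π x = 1) {f : X → ℝ}
    {B : ℝ} (hf : ∀ x y, |f x - f y| ≤ B) (x : X) : |f x - ∑ y, π y * f y| ≤ B := by
  have e : f x - ∑ y, π y * f y = ∑ y, π y * (f x - f y) := by
    simp_rw [mul_sub, sum_sub_distrib, ← sum_mul, hπ1, one_mul]
  rw [e]
  calc |∑ y, π y * (f x - f y)| ≤ ∑ y, |π y * (f x - f y)| := abs_sum_le_sum_abs _ _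
    _ ≤ ∑ y, π y * B := sum_le_sum fun y _ => by
        rw [abs_mul, abs_of_nonneg (hπ y)]
        exact mul_le_mul_of_nonneg_left (hf x y) (hπ y)
    _ = B := by rw [← sum_mul, hπ1, one_mul]

/-- **Second moments transfer from the marginal to the equilibrium law at `χ²` cost**: for a
unit-mass `μ`, a positive probability vector `π`, and `|φ − c| ≤ B` pointwise,
`Σ μ (φ − c)² ≤ Σ π (φ − c)² + √χ²(μ ‖ π)·B·√(Σ π (φ − c)²)`. -/
theorem sum_mul_sq_le_add_sqrt_chiSqDiv [Nonempty X] {μ π : X → ℝ} (hπ : ∀ x, 0 < π x) (hμ1 : ∑ x, μ x = 1)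
    (hπ1 : ∑ x, π x = 1) {φ : X → ℝ} {c B : ℝ} (hB : ∀ x, |φ x - c| ≤ B) :
    ∑ x, μ x * (φ x - c) ^ 2
      ≤ ∑ x, π x * (φ x - c) ^ 2
        + Real.sqrt (chiSqDiv μ π) * (B * Real.sqrt (∑ x, π x * (φ x - c) ^ 2)) := by
  have h := abs_sum_mul_sub_sum_mul_le hπ hμ1 hπ1 (fun x => (φ x - c) ^ 2)
  have hB0 : 0 ≤ B := (abs_nonneg _).trans (hB (Classical.arbitrary X))
  -- Var_π((φ − c)²) ≤ B² Σ π (φ − c)²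
  have hvar : lawVariance π (fun x => (φ x - c) ^ 2) ≤ B ^ 2 * ∑ x, π x * (φ x - c) ^ 2 := by
    unfold lawVariance lawMean
    calc ∑ x, π x * ((φ x - c) ^ 2 - ∑ y, π y * (φ y - c) ^ 2) ^ 2
        ≤ ∑ x, π x * ((φ x - c) ^ 2) ^ 2 := by
          have := sum_mul_sq_sub_mean_le hπ1 (fun x => (φ x - c) ^ 2) 0
          simpa using this
      _ ≤ ∑ x, π x * (B ^ 2 * (φ x - c) ^ 2) := sum_le_sum fun x _ =>
          mul_le_mul_of_nonneg_left (by
            rw [show ((φ x - c) ^ 2) ^ 2 = (φ x - c) ^ 2 * (φ x - c) ^ 2 by ring]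
            refine mul_le_mul_of_nonneg_right ?_ (sq_nonneg _)
            calc (φ x - c) ^ 2 = |φ x - c| ^ 2 := (sq_abs _).symm
              _ ≤ B ^ 2 := pow_le_pow_left₀ (abs_nonneg _) (hB x) 2) (hπ x).le
      _ = B ^ 2 * ∑ x, π x * (φ x - c) ^ 2 := by
          rw [mul_sum]; exact sum_congr rfl fun x _ => by ring
  have hsq : Real.sqrt (lawVariance π (fun x => (φ x - c) ^ 2))
      ≤ B * Real.sqrt (∑ x, π x * (φ x - c) ^ 2) := by
    rw [← Real.sqrt_sq hB0, ← Real.sqrt_mul (sq_nonneg B)]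
    exact Real.sqrt_le_sqrt hvar
  have h2 := (abs_le.mp h).2
  have h3 : Real.sqrt (chiSqDiv μ π) * Real.sqrt (lawVariance π fun x => (φ x - c) ^ 2)
      ≤ Real.sqrt (chiSqDiv μ π) * (B * Real.sqrt (∑ x, π x * (φ x - c) ^ 2)) :=
    mul_le_mul_of_nonneg_left hsq (Real.sqrt_nonneg _)
  linarith


end Summit.Ventures.LatticeQCDFlow.Scaling
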